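import Summits.BirchSwinnertonDyer.Rank1Residual.P2.CMKolyvaginCartanCommuteAtTwoLevel
import Summits.BirchSwinnertonDyer.BirchSwinnertonDyer.Theorems.CMKolyvaginAtInertTwoBottomBitsAtTwo
import HarnessLib

/-!
# Route `CMKolyvaginAtInertTwo`, crux `CMKolyvaginExactAtInertTwo` (stmt-BirchSwinnertonDyer-24277):
# the ANTI-COMMUTATION ENGINE at level `2^M` — an additive injection `t` of `E(k̄)` which fixes one
# non-zero `2`-torsion point, moves another, and normalises an `η`-commuting Galois element without
# fixed points on `E[2]`, conjugates the CM generator `η` (`η² + mη = c`, `m, c` odd) to `η̄ = −η − m`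
# on `E[2^M]`: `η(tP) = −t(ηP) − m·tP`

Seat `bsd-line-cmk2-p1` g10 (cell `bsd-print-cf2`); helper (`--supports stmt-BirchSwinnertonDyer-24277`).
THEOREMS ONLY: no definition, no named fact, no `sorry`; no item is closed; BSD is not proved by this.
Memo `Cruxes/CMExactDescentAtTwo/MEMO-inert-order-splitting.md` §3–4: this is the `E[2^M]`-level input
`hanti` of `InertOrderSplittingH1.conjAct_anti` / `natCard_stable_eq_sq` for a LIFT `t = τ̃` of an
automorphism `σ` of `K/k` (`t = IsLiftOfAut.pointsMap`, `z' = conjGalCMH z`, `t(z'P) = z(tP)` is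
`IsLiftOfAut.pointsMap_smul`), complementing ty2's `CartanAtTwo.dichotomy` (stated for elements of `Γ_k`
only): the second case of the dichotomy for `τ̃` is DERIVED from (i) `τ̃` acts on `E[2]` as a transposition
(one fixed non-zero point, one moved point — complex conjugation on `Δ < 0`), (ii) `τ̃` normalises an
`η`-commuting element `z'` without fixed point on `E[2]` into an `η`-commuting `z`.

Mechanism (Hensel in disguise, no `½`): with `P₁` of exact order `2^M`, `Q₁ = tP₁` and
`t(ηP₁) = aQ₁ + bηQ₁`, the operator `w = a + bη` satisfies `w² + mw = c` on `E[2^M]` (from `t z' = z t`,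
`anti_engine_claim0`), `t ∘ η = w ∘ t` (`anti_engine_claim1`), `w − η` is injective on `E[2^M]` (on `E[2]`
because `t` is a transposition, `anti_engine_claim2`, then bottom bits), and `(w − η)(w − η̄) = w² + mw − c = 0`
(`anti_engine_claim4`); hence `w = η̄` (`anti_of_transposition_of_normalizer`). References: Lang, *Elliptic
Functions*, Ch. 10 §4 Remark [Lang1987]; Silverman *AEC* III.§4 [SilvermanAEC2009]; folklore.
-/

-- single-conjunct summit: `Summit.BirchSwinnertonDyer.BirchSwinnertonDyer.…` repeats the name by design
set_option linter.dupNamespace false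
set_option autoImplicit false

noncomputable section

open scoped Classical

namespace Summit.BirchSwinnertonDyer.BirchSwinnertonDyer.Theorems.CartanAtTwoPow

open WeierstrassCurve Field
open Literature.NumberTheory.EllipticCurves
open Summit.BirchSwinnertonDyer.Rank1Residual.P2.CartanAtTwo

universe u

variable {k : Type u} [Field k] {V : WeierstrassCurve k} {η : AddMonoid.End (geomPoints V)} {m c : ℤ}

/-! ## §1 Linear algebra over `ℤ[η]` -/

/-- `η` is `ℤ[η]`-linear: `η(aX + bηX) = aηX + bη(ηX)`. [folklore] -/
theorem eta_lin (a b : ℤ) (X : geomPoints V) : η (a • X + b • η X) = a • η X + b • η (η X) := by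
  rw [map_add, map_zsmul, map_zsmul]

/-- `ℤ[η]` is commutative: `(a + bη)(a' + b'η)X = (a' + b'η)(a + bη)X`. [folklore] -/
theorem lin_comm (a b a' b' : ℤ) (X : geomPoints V) :
    a • (a' • X + b' • η X) + b • η (a' • X + b' • η X) =
      a' • (a • X + b • η X) + b' • η (a • X + b • η X) := by
  rw [eta_lin, eta_lin]
  module

/-- An `η`-commuting Galois element acting as `a' + b'η` on a point `P₁` acts as `a' + b'η` on
`ℤP₁ + ℤηP₁`. [folklore] -/
theorem smul_eq_lin_of_coords {ρ : absoluteGaloisGroup k} (hρ : ∀ P : geomPoints V, ρ • η P = η (ρ • P))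
    {P₁ : geomPoints V} {a' b' : ℤ} (h₁ : ρ • P₁ = a' • P₁ + b' • η P₁) (x y : ℤ) :
    ρ • (x • P₁ + y • η P₁) = a' • (x • P₁ + y • η P₁) + b' • η (x • P₁ + y • η P₁) := by
  rw [smul_coords hρ, h₁, ← lin_comm]

/-- An element killed by `2^M` and by an odd integer is `0`. [folklore] -/
theorem eq_zero_of_odd_zsmul {N : ℤ} (hN : Odd N) {M : ℕ} {X : geomPoints V}
    (h2 : (2 : ℤ) ^ M • X = 0) (h : N • X = 0) : X = 0 := by
  have hcop : IsCoprime N ((2 : ℤ) ^ M) := by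
    obtain ⟨j, rfl⟩ := hN
    exact (show IsCoprime (2 * j + 1) (2 : ℤ) from ⟨1, -j, by ring⟩).pow_right
  obtain ⟨u, w, huw⟩ := hcop
  calc X = (u * N + w * 2 ^ M) • X := by rw [huw, one_zsmul]
    _ = 0 := by rw [add_zsmul, mul_zsmul, mul_zsmul, h, h2, zsmul_zero, zsmul_zero, add_zero]

/-- The polynomial operator `F = w² + mw − c`, `w = a + bη`, is `ℤ[η]`-linear: its value on `xQ + yηQ`
is `x·F(Q) + y·η F(Q)`. [folklore] -/
theorem poly_lin (hrel : ∀ P : geomPoints V, η (η P) + m • η P = c • P) (a b x y : ℤ) (Q : geomPoints V) :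
    a • (a • (x • Q + y • η Q) + b • η (x • Q + y • η Q)) +
        b • η (a • (x • Q + y • η Q) + b • η (x • Q + y • η Q)) +
        m • (a • (x • Q + y • η Q) + b • η (x • Q + y • η Q)) - c • (x • Q + y • η Q) =
      x • (a • (a • Q + b • η Q) + b • η (a • Q + b • η Q) + m • (a • Q + b • η Q) - c • Q) +
        y • η (a • (a • Q + b • η Q) + b • η (a • Q + b • η Q) + m • (a • Q + b • η Q) - c • Q) := by
  have h3 : η (η (η Q)) = c • η Q - m • η (η Q) := by
    rw [← map_zsmul η c Q, ← map_zsmul η m (η Q), ← map_sub, (eq_sub_of_add_eq (hrel Q))]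
  simp only [map_add, map_sub, map_zsmul, h3]
  module

/-- If an odd-`b'` element `a' + b'η` of `ℤ[η]` FIXES a non-zero `2`-torsion point `R` it acts trivially
on `E[2]`; contrapositively, an element `z'` without fixed non-zero point on `E[2]` acting on `R` as
`a'R + b'ηR` has `b'` ODD. [folklore] -/
theorem odd_coeff_of_fixedPointFree {z' : absoluteGaloisGroup k}
    (hz' : ∀ P : geomPoints V, (2 : ℤ) • P = 0 → z' • P = P → P = 0) {R : geomPoints V} (hR : R ≠ 0)
    (h2R : (2 : ℤ) • R = 0) {a' b' : ℤ} (hzR : z' • R = a' • R + b' • η R) : Odd b' := by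
  by_contra hb
  rw [Int.not_odd_iff_even] at hb
  obtain ⟨β, rfl⟩ := hb
  have hηR : (β + β) • η R = 0 := by
    rw [← two_mul, mul_comm, mul_zsmul, two_zsmul_map_eq_zero η h2R, zsmul_zero]
  rw [hηR, add_zero] at hzR
  rcases Int.even_or_odd a' with ⟨α, rfl⟩ | ha
  · have h0 : z' • R = 0 := by rw [hzR, ← two_mul, mul_comm, mul_zsmul, h2R, zsmul_zero]
    have : R = 0 := by
      have h := congrArg (fun X ↦ z'⁻¹ • X) h0
      simpa only [inv_smul_smul, smul_zero] using h
    exact hR this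
  · rw [zsmul_eq_self_of_odd h2R ha] at hzR
    exact hR (hz' R h2R hzR)

/-- **Claim 0.** With `Q₁ = tP₁`, `U = t(ηP₁) = aQ₁ + bηQ₁`, `z` acting as `a₀ + b₀η` on `Q₁`, `z'` acting
as `a' + b'η` on `P₁, ηP₁` with `b'` odd, and `t z' = z t` on `P₁, ηP₁`: `(w² + mw − c)Q₁ = 0` for
`w = a + bη`, i.e. `a·wQ₁ + b·η(wQ₁) + m·wQ₁ = c·Q₁` (apply `w` to `t(z'P₁) = zQ₁` and compare with
`t(z'ηP₁) = z·t(ηP₁)`; cancel the odd `b'`). [folklore] -/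
theorem anti_engine_claim0 (hrel : ∀ P : geomPoints V, η (η P) + m • η P = c • P)
    (t : geomPoints V →+ geomPoints V) {z z' : absoluteGaloisGroup k}
    (hzη : ∀ P : geomPoints V, z • η P = η (z • P))
    {M : ℕ} {P₁ : geomPoints V} {a b a' b' a₀ b₀ : ℤ}
    (hU : t (η P₁) = a • t P₁ + b • η (t P₁))
    (hz'P : z' • P₁ = a' • P₁ + b' • η P₁) (hz'ηP : z' • η P₁ = a' • η P₁ + b' • η (η P₁))
    (hb' : Odd b') (hzQ : z • t P₁ = a₀ • t P₁ + b₀ • η (t P₁))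
    (hconjP : t (z' • P₁) = z • t P₁) (hconjηP : t (z' • η P₁) = z • t (η P₁))
    (htor : (2 : ℤ) ^ M • t P₁ = 0) :
    a • (a • t P₁ + b • η (t P₁)) + b • η (a • t P₁ + b • η (t P₁)) + m • (a • t P₁ + b • η (t P₁)) =
      c • t P₁ := by
  have hηη : η (η P₁) = c • P₁ - m • η P₁ := eq_sub_of_add_eq (hrel P₁)
  -- (E1): `t(z'P₁) = zQ₁`
  have E1 : a' • t P₁ + b' • (a • t P₁ + b • η (t P₁)) - (a₀ • t P₁ + b₀ • η (t P₁)) = 0 := by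
    rw [sub_eq_zero, ← hU, ← hzQ, ← hconjP, hz'P, map_add, map_zsmul, map_zsmul]
  -- (ηE1)
  have E1η : a' • η (t P₁) + b' • (a • η (t P₁) + b • η (η (t P₁))) -
      (a₀ • η (t P₁) + b₀ • η (η (t P₁))) = 0 := by
    have h := congrArg η E1
    simpa only [map_sub, map_add, map_zsmul, map_zero] using h
  -- (E2): `t(z'ηP₁) = z·t(ηP₁)`
  have E2 : a' • (a • t P₁ + b • η (t P₁)) + b' • (c • t P₁ - m • (a • t P₁ + b • η (t P₁))) -
      (a • (a₀ • t P₁ + b₀ • η (t P₁)) + b • (a₀ • η (t P₁) + b₀ • η (η (t P₁)))) = 0 := by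
    have h := hconjηP
    rw [hz'ηP, hηη, map_add, map_zsmul, map_zsmul, map_sub, map_zsmul, map_zsmul, hU,
      smul_coords hzη, hzQ, eta_lin] at h
    exact sub_eq_zero.mpr h
  -- `b' · F(Q₁) = a · E1 + b · ηE1 − E2`
  have key : b' • (a • (a • t P₁ + b • η (t P₁)) + b • η (a • t P₁ + b • η (t P₁)) +
      m • (a • t P₁ + b • η (t P₁)) - c • t P₁) = 0 := by
    have h : b' • (a • (a • t P₁ + b • η (t P₁)) + b • η (a • t P₁ + b • η (t P₁)) +
        m • (a • t P₁ + b • η (t P₁)) - c • t P₁) =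
        a • (a' • t P₁ + b' • (a • t P₁ + b • η (t P₁)) - (a₀ • t P₁ + b₀ • η (t P₁))) +
        b • (a' • η (t P₁) + b' • (a • η (t P₁) + b • η (η (t P₁))) -
          (a₀ • η (t P₁) + b₀ • η (η (t P₁)))) -
        (a' • (a • t P₁ + b • η (t P₁)) + b' • (c • t P₁ - m • (a • t P₁ + b • η (t P₁))) -
          (a • (a₀ • t P₁ + b₀ • η (t P₁)) + b • (a₀ • η (t P₁) + b₀ • η (η (t P₁))))) := by
      rw [eta_lin]
      module
    rw [h, E1, E1η, E2, smul_zero, smul_zero, add_zero, sub_zero]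
  have htorF : (2 : ℤ) ^ M • (a • (a • t P₁ + b • η (t P₁)) + b • η (a • t P₁ + b • η (t P₁)) +
      m • (a • t P₁ + b • η (t P₁)) - c • t P₁) = 0 := by
    have hη1 : (2 : ℤ) ^ M • η (t P₁) = 0 := by rw [← map_zsmul, htor, map_zero]
    have hη2 : (2 : ℤ) ^ M • η (η (t P₁)) = 0 := by rw [← map_zsmul, hη1, map_zero]
    have h : (2 : ℤ) ^ M • (a • (a • t P₁ + b • η (t P₁)) + b • η (a • t P₁ + b • η (t P₁)) +
        m • (a • t P₁ + b • η (t P₁)) - c • t P₁) =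
        (a * a + m * a - c) • ((2 : ℤ) ^ M • t P₁) + (a * b + b * a + m * b) • ((2 : ℤ) ^ M • η (t P₁)) +
        (b * b) • ((2 : ℤ) ^ M • η (η (t P₁))) := by
      rw [eta_lin]
      module
    rw [h, htor, hη1, hη2, smul_zero, smul_zero, smul_zero, add_zero, add_zero]
  exact sub_eq_zero.mp (eq_zero_of_odd_zsmul hb' htorF key)

/-- **Claim 1.** `t ∘ η = w ∘ t` on `E[2^M] = ℤP₁ + ℤηP₁`: `t(ηP) = a·tP + b·η(tP)`, from Claim 0 at `Q₁`.
[folklore] -/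
theorem anti_engine_claim1 (hrel : ∀ P : geomPoints V, η (η P) + m • η P = c • P)
    (t : geomPoints V →+ geomPoints V) {P₁ : geomPoints V} {a b : ℤ}
    (hU : t (η P₁) = a • t P₁ + b • η (t P₁))
    (hC0 : a • (a • t P₁ + b • η (t P₁)) + b • η (a • t P₁ + b • η (t P₁)) +
      m • (a • t P₁ + b • η (t P₁)) = c • t P₁)
    (x y : ℤ) : t (η (x • P₁ + y • η P₁)) = a • t (x • P₁ + y • η P₁) + b • η (t (x • P₁ + y • η P₁)) := by
  have hηη : η (η P₁) = c • P₁ - m • η P₁ := eq_sub_of_add_eq (hrel P₁)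
  rw [eta_lin, hηη, map_add, map_zsmul, map_zsmul, map_sub, map_zsmul, map_zsmul, hU, map_add,
    map_zsmul, map_zsmul, hU]
  calc x • (a • t P₁ + b • η (t P₁)) + y • (c • t P₁ - m • (a • t P₁ + b • η (t P₁)))
      = a • (x • t P₁ + y • (a • t P₁ + b • η (t P₁))) + b • η (x • t P₁ + y • (a • t P₁ + b • η (t P₁))) +
        y • (c • t P₁ - (a • (a • t P₁ + b • η (t P₁)) + b • η (a • t P₁ + b • η (t P₁)) +
          m • (a • t P₁ + b • η (t P₁)))) := by
        simp only [map_add, map_zsmul]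
        module
    _ = a • (x • t P₁ + y • (a • t P₁ + b • η (t P₁))) + b • η (x • t P₁ + y • (a • t P₁ + b • η (t P₁))) := by
        rw [hC0, sub_self, smul_zero, add_zero]

/-- **Claim 3** (bottom bits): if `w − η` kills no non-zero point of `E[2]` it kills no non-zero point of
`E[2^M]`. [folklore] -/
theorem anti_engine_claim3 {a b : ℤ}
    (h2 : ∀ Y : geomPoints V, (2 : ℤ) • Y = 0 → a • Y + b • η Y = η Y → Y = 0)
    {M : ℕ} {X : geomPoints V} (hX : (2 : ℤ) ^ M • X = 0) (hwX : a • X + b • η X = η X) : X = 0 := by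
  by_contra hne
  have hX' : (((2 : ℕ) : ℤ) ^ M) • X = 0 := by exact_mod_cast hX
  obtain ⟨j, -, hj, hj2⟩ := KolyvaginDescentTwo.exists_two_pow_zsmul_ne_zero_two_zsmul_eq_zero M hX' hne
  have hj2' : (2 : ℤ) • ((((2 : ℕ) : ℤ) ^ j) • X) = 0 := by exact_mod_cast hj2
  refine hj (h2 _ hj2' ?_)
  have h : a • ((((2 : ℕ) : ℤ) ^ j) • X) + b • η ((((2 : ℕ) : ℤ) ^ j) • X) =
      (((2 : ℕ) : ℤ) ^ j) • (a • X + b • η X) := by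
    rw [map_zsmul, smul_add, smul_comm (((2 : ℕ) : ℤ) ^ j) a X, smul_comm (((2 : ℕ) : ℤ) ^ j) b (η X)]
  rw [h, hwX, map_zsmul]

/-- **Claim 4** (the factorisation `(w − η)(w − η̄) = w² + mw − c`): if `F(X) := a·wX + b·η(wX) + m·wX − c·X`
vanishes, then `Y := wX − η̄X = a·X + b·ηX + ηX + m·X` satisfies `(w − η)Y = 0`. [folklore] -/
theorem anti_engine_claim4 (hrel : ∀ P : geomPoints V, η (η P) + m • η P = c • P) {a b : ℤ}
    {X : geomPoints V}
    (hF : a • (a • X + b • η X) + b • η (a • X + b • η X) + m • (a • X + b • η X) = c • X) :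
    a • (a • X + b • η X + η X + m • X) + b • η (a • X + b • η X + η X + m • X) =
      η (a • X + b • η X + η X + m • X) := by
  have h := hrel X
  calc a • (a • X + b • η X + η X + m • X) + b • η (a • X + b • η X + η X + m • X)
      = (a • (a • X + b • η X) + b • η (a • X + b • η X) + m • (a • X + b • η X))
          + (a • η X + b • η (η X)) := by
        simp only [map_add, map_zsmul]
        module
    _ = η (a • X + b • η X + η X + m • X) := by
        rw [hF, ← h, map_add, map_add, map_add, map_zsmul, map_zsmul, map_zsmul]
        module

/-! ## §2 The engine -/

section Engine

variable [CharZero k] [V.IsElliptic]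

/-- **Claim 2** (the transposition bites): if `t(ηY) = a·tY + b·η(tY)` on `E[2]`, `t` fixes a non-zero
`2`-torsion point and moves a `2`-torsion point, then `w − η` (`w = a + bη`) kills no non-zero point of
`E[2]` (else `w = η` on `E[2] = {0, X, ηX, X + ηX}`, `t` is `𝔽₄`-linear on `E[2]` with a fixed vector,
hence trivial there). [folklore] -/
theorem anti_engine_claim2 (hrel : ∀ P : geomPoints V, η (η P) + m • η P = c • P)
    (hm : Odd m) (hc : Odd c) (t : geomPoints V →+ geomPoints V) {a b : ℤ}
    (hlin : ∀ Y : geomPoints V, (2 : ℤ) • Y = 0 → t (η Y) = a • t Y + b • η (t Y))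
    (hfix : ∃ X₀ : geomPoints V, X₀ ≠ 0 ∧ (2 : ℤ) • X₀ = 0 ∧ t X₀ = X₀)
    (hmove : ∃ Y₁ : geomPoints V, (2 : ℤ) • Y₁ = 0 ∧ t Y₁ ≠ Y₁)
    {X : geomPoints V} (h2X : (2 : ℤ) • X = 0) (hwX : a • X + b • η X = η X) : X = 0 := by
  have hcard : Nat.card (geomTorsion V ((2 : ℕ) : ℤ)) = 4 := by
    simpa using natCard_geomTorsion_two_pow V 1
  by_contra hX
  -- `w = η` on all of `E[2] = {0, X, ηX, X + ηX}`
  have hw : ∀ Y : geomPoints V, (2 : ℤ) • Y = 0 → a • Y + b • η Y = η Y := by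
    intro Y h2Y
    have hηX : a • η X + b • η (η X) = η (η X) := by rw [← eta_lin, hwX]
    rcases two_torsion_cases hrel hm hc hcard hX h2X Y h2Y with rfl | rfl | rfl | rfl
    · rw [smul_zero, map_zero, smul_zero, add_zero]
    · exact hwX
    · exact hηX
    · calc a • (X + η X) + b • η (X + η X) = (a • X + b • η X) + (a • η X + b • η (η X)) := by
            rw [map_add]; module
        _ = η (X + η X) := by rw [hwX, hηX, map_add]
  -- hence `t(ηY) = η(tY)` on `E[2]`, and `t` fixes `E[2]` pointwise
  obtain ⟨X₀, hX₀, h2X₀, htX₀⟩ := hfix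
  obtain ⟨Y₁, h2Y₁, htY₁⟩ := hmove
  have h2t : ∀ Y : geomPoints V, (2 : ℤ) • Y = 0 → (2 : ℤ) • t Y = 0 := fun Y h ↦ by
    rw [← map_zsmul, h, map_zero]
  have htη : t (η X₀) = η X₀ := by rw [hlin X₀ h2X₀, htX₀, hw X₀ h2X₀]
  apply htY₁
  rcases two_torsion_cases hrel hm hc hcard hX₀ h2X₀ Y₁ h2Y₁ with rfl | rfl | rfl | rfl
  · exact map_zero t
  · exact htX₀
  · exact htη
  · rw [map_add, htX₀, htη]

/-- **THE ENGINE: a transposition-type normaliser conjugates `η` to `η̄` on `E[2^M]`.** Let `E = V/k`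
(characteristic `0`) carry an additive endomorphism `η` of `E(k̄)` with `η² + mη = c`, `m, c` odd (the CM
generator of an order in which `2` is inert). Let `t : E(k̄) → E(k̄)` be additive and injective (a lift of
an automorphism of the ground field acting on points), `z, z' ∈ Γ_k` commuting with `η`, `z'` without
non-zero fixed point on `E[2]`, with `t(z'P) = z(tP)`; suppose `t` fixes a non-zero `2`-torsion point and
moves a `2`-torsion point. Then for every `P ∈ E[2^M]`: `η(tP) = −t(ηP) − m·tP`, i.e. `t η t⁻¹ = η̄`.
[cite: Lang1987, Ch. 10 §4, Remark] -/
theorem anti_of_transposition_of_normalizer (hrel : ∀ P : geomPoints V, η (η P) + m • η P = c • P)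
    (hm : Odd m) (hc : Odd c) (t : geomPoints V →+ geomPoints V) (ht : Function.Injective t)
    {z z' : absoluteGaloisGroup k} (hzη : ∀ P : geomPoints V, z • η P = η (z • P))
    (hz'η : ∀ P : geomPoints V, z' • η P = η (z' • P))
    (hz' : ∀ P : geomPoints V, (2 : ℤ) • P = 0 → z' • P = P → P = 0)
    (hconj : ∀ P : geomPoints V, t (z' • P) = z • t P)
    (hfix : ∃ X₀ : geomPoints V, X₀ ≠ 0 ∧ (2 : ℤ) • X₀ = 0 ∧ t X₀ = X₀)
    (hmove : ∃ Y₁ : geomPoints V, (2 : ℤ) • Y₁ = 0 ∧ t Y₁ ≠ Y₁)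
    (M : ℕ) (P : geomPoints V) (hP : (2 : ℤ) ^ M • P = 0) : η (t P) = -t (η P) - m • t P := by
  rcases Nat.eq_zero_or_pos M with hM0 | hM
  · subst hM0
    rw [pow_zero, one_zsmul] at hP
    subst hP
    simp only [map_zero, smul_zero, neg_zero, sub_zero]
  have hcards := natCard_geomTorsion_two_pow V
  have hcard : Nat.card (geomTorsion V ((2 : ℕ) : ℤ)) = 4 := by simpa using hcards 1
  -- a generator `P₁` of `E[2^M]` over `ℤ[η]`, its image `Q₁ = t P₁`, and coordinates
  obtain ⟨P₁, h1, hne⟩ := exists_exact_order hcards hM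
  have hQ1 : (2 : ℤ) ^ M • t P₁ = 0 := by rw [← map_zsmul, h1, map_zero]
  have hQne : (2 : ℤ) ^ (M - 1) • t P₁ ≠ 0 := fun h ↦
    hne (ht (by rw [map_zsmul, h, map_zero]))
  have h2pow : ∀ {X : geomPoints V}, (2 : ℤ) ^ M • X = 0 → (2 : ℤ) ^ M • η X = 0 := fun h ↦ by
    rw [← map_zsmul, h, map_zero]
  obtain ⟨a, b, hU⟩ := exists_coords hrel hm hc hcard M (t P₁) hQ1 (Or.inr hQne) (t (η P₁))
    (by rw [← map_zsmul, h2pow h1, map_zero])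
  obtain ⟨a', b', hz'P⟩ := exists_coords hrel hm hc hcard M P₁ h1 (Or.inr hne) (z' • P₁)
    (by rw [← smul_zsmul_geomPoints, h1, smul_zero])
  obtain ⟨a₀, b₀, hzQ⟩ := exists_coords hrel hm hc hcard M (t P₁) hQ1 (Or.inr hQne) (z • t P₁)
    (by rw [← smul_zsmul_geomPoints, hQ1, smul_zero])
  have hz'ηP : z' • η P₁ = a' • η P₁ + b' • η (η P₁) := by rw [hz'η, hz'P, eta_lin]
  -- `b'` is odd: `z'` acts as `a' + b'η` on the bottom bit `R = 2^{M-1} P₁ ≠ 0`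
  have h2R : (2 : ℤ) • (2 : ℤ) ^ (M - 1) • P₁ = 0 := by
    rw [smul_smul, ← pow_succ', Nat.sub_add_cancel hM, h1]
  have hzR : z' • (2 : ℤ) ^ (M - 1) • P₁ =
      a' • (2 : ℤ) ^ (M - 1) • P₁ + b' • η ((2 : ℤ) ^ (M - 1) • P₁) := by
    rw [smul_zsmul_geomPoints, hz'P, map_zsmul]
    module
  have hb' : Odd b' := odd_coeff_of_fixedPointFree hz' hne h2R hzR
  -- Claim 0 and its extension to `E[2^M] = ℤQ₁ + ℤηQ₁`
  have hC0 := anti_engine_claim0 hrel t hzη hU hz'P hz'ηP hb' hzQ (hconj P₁) (hconj (η P₁)) hQ1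
  have hC0' : ∀ X : geomPoints V, (2 : ℤ) ^ M • X = 0 →
      a • (a • X + b • η X) + b • η (a • X + b • η X) + m • (a • X + b • η X) = c • X := by
    intro X hX
    obtain ⟨x, y, rfl⟩ := exists_coords hrel hm hc hcard M (t P₁) hQ1 (Or.inr hQne) X hX
    have h := poly_lin hrel a b x y (t P₁)
    rw [sub_eq_zero.mpr hC0, map_zero, smul_zero, smul_zero, add_zero, sub_eq_zero] at h
    exact h
  -- Claim 1: `t η = w t` on `E[2^M]`
  have hC1 : ∀ P' : geomPoints V, (2 : ℤ) ^ M • P' = 0 → t (η P') = a • t P' + b • η (t P') := by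
    intro P' hP'
    obtain ⟨x, y, rfl⟩ := exists_coords hrel hm hc hcard M P₁ h1 (Or.inr hne) P' hP'
    exact anti_engine_claim1 hrel t hU hC0 x y
  -- Claims 2–3: `w − η` kills no non-zero point of `E[2^M]`
  have h2M : ∀ Y : geomPoints V, (2 : ℤ) • Y = 0 → (2 : ℤ) ^ M • Y = 0 := fun Y h ↦ by
    rw [← Nat.sub_add_cancel hM, pow_succ, ← smul_smul, h, smul_zero]
  have hC2 : ∀ Y : geomPoints V, (2 : ℤ) • Y = 0 → a • Y + b • η Y = η Y → Y = 0 :=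
    fun Y h2Y hwY ↦ anti_engine_claim2 hrel hm hc t (fun Y' h ↦ hC1 Y' (h2M Y' h)) hfix hmove h2Y hwY
  -- Claim 4 at `X = tP`, then conclude
  have hY0 : a • t P + b • η (t P) + η (t P) + m • t P = 0 := by
    have htP : (2 : ℤ) ^ M • t P = 0 := by rw [← map_zsmul, hP, map_zero]
    refine anti_engine_claim3 hC2 (M := M) ?_ (anti_engine_claim4 hrel (hC0' (t P) htP))
    have hη1 : (2 : ℤ) ^ M • η (t P) = 0 := h2pow htP
    rw [smul_add, smul_add, smul_add, smul_comm ((2 : ℤ) ^ M) a, smul_comm ((2 : ℤ) ^ M) b,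
      smul_comm ((2 : ℤ) ^ M) m, htP, hη1, smul_zero, smul_zero, smul_zero, zero_add, zero_add, zero_add]
  rw [← hC1 P hP] at hY0
  -- `hY0 : t (η P) + η (t P) + m • t P = 0`
  have h := eq_neg_of_add_eq_zero_left (show t (η P) + (η (t P) + m • t P) = 0 by rw [← add_assoc]; exact hY0)
  -- `h : t (η P) = -(η (t P) + m • t P)`
  rw [h]; abel

end Engine

end Summit.BirchSwinnertonDyer.BirchSwinnertonDyer.Theorems.CartanAtTwoPow
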